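import Mathlib.LinearAlgebra.Matrix.GeneralLinearGroup.Defs
import Mathlib.Data.ZMod.Basic
import Mathlib.Algebra.Group.Subgroup.Map
import Mathlib.Algebra.Group.Subgroup.Ker
import Mathlib.Tactic.NoncommRing
import HarnessLib

/-!
# Surjectivity of a `2`-adic image is decided modulo `8` (Serre; Vasiu 2003, Lemma 4.1.2 at `p = 2`) — THEOREMS, no named fact

Topic `NumberTheory/GaloisRepresentations`.  The finite-level form of the classical lifting lemma
behind "`ρ̄_{E,8}` surjective ⟹ `ρ_{E,2^∞}` surjective" for the `2`-adic Galois representation of an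
elliptic curve:

* `generalLinearGroup_eq_top_of_map_castHom_eq_top` — for `3 ≤ k`, a subgroup of
  `GL_ι(ℤ/2^{k+1}ℤ)` whose image under reduction modulo `2^k` is all of `GL_ι(ℤ/2^kℤ)` is all of
  `GL_ι(ℤ/2^{k+1}ℤ)` (any finite index type `ι`);
* `generalLinearGroup_eq_top_of_map_castHom_eight_eq_top` — for `3 ≤ k`, a subgroup of
  `GL_ι(ℤ/2^kℤ)` whose image modulo `2^3 = 8` is everything is everything (induction on `k`);
* `surjective_of_surjective_castHom_comp`, `surjective_of_surjective_castHom_eight_comp` — the same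
  for the image of a homomorphism `ρ : G →* GL_ι(ℤ/2^{k+1}ℤ)` resp. `GL_ι(ℤ/2^kℤ)`.

Source.  A. Vasiu, *Surjectivity criteria for p-adic representations, Part I*, Manuscripta Math.
**112** (2003) 325–355, **Lemma 4.1.2** (arXiv:math/0209237, p. 11): "If `p = 2` (resp. `p > 2`) let
`m := 3` (resp. `m := 2`).  If `K` surjects onto `G(W_m(k))`, then `K = G(W(k))`" (`K` a closed
subgroup of `G(W(k))`, `G` a reductive group scheme over the Witt ring `W(k)`), with the remark "If
`p = 2`, then 4.1.2 does not hold in general if we replace `m = 3` by `m = 2`", and the attribution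
"This is just the generalization of [Serre, *Abelian l-adic representations and elliptic curves*,
Exc. 1 p. IV-27]".  Vasiu's proof is the `p`-th power trick: an element `1 + p^s x` of the
congruence kernel is, modulo `p^{s+1}`, the `p`-th power of any lift of `1 + p^{s-1} x`, for `s ≥ 3`
when `p = 2`.  The present file proves exactly this at ONE finite level for `p = 2` and
`G = GL_ι` over `W(𝔽₂) = ℤ₂` — where `G(W_s(𝔽₂)) = GL_ι(ℤ/2^sℤ)` — and iterates it; the profinite
statement (closed subgroups of `GL_ι(ℤ₂)`) follows from the finite one by compactness and is not
needed by the consumer below.  Dokchitser–Dokchitser, Math. Z. **272** (2012) 961–964, Introduction,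
record that the lifting `ρ̄_{ℓⁿ}` surjective ⟹ `ρ̄_{ℓⁿ⁺¹}` surjective FAILS exactly for `ℓⁿ ∈ {2, 3, 4}`;
their Theorem decides surjectivity modulo `8`.

Proof (level `k + 1` over level `k`, `k = m + 3 ≥ 3`; all matrices over `R = ℤ/2^{k+1}ℤ`, where
`2^{k+1} = 0`).  Let `π : GL_ι(R) → GL_ι(ℤ/2^k)` be reduction and `H ≤ GL_ι(R)` with `π(H)` everything.
It suffices to show `ker π ⊆ H`.  An element of `ker π` is `κ = 1 + 2^k A` (entries killed by
reduction are multiples of `2^k`).  The matrix `u₀ = 1 + 2^{k-1} A` is invertible (inverse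
`1 - X + X²`, `X = 2^{k-1} A`, since `X³ = 2^{3k-3} A³ = 0`), so some `h ∈ H` has `π h = π u₀`, i.e.
`h = 1 + 2^{k-1} A + 2^k B`.  Squaring, every cross term carries `2^{2k-2}`, `2^{2k-1}` or `2^{2k}`,
all `0` modulo `2^{k+1}` BECAUSE `k ≥ 3` (`2k - 2 ≥ k + 1`), and `2·2^k B = 0`, so `h² = 1 + 2^k A = κ`
and `κ ∈ H`.  (At `k = 2` the term `2^{2k-2} A² = 4A²` survives modulo `8` — the "4 not 8"
phenomenon.)

Written for the BSD residual cell `b2b-bsdres`, class O1 (`p = 2`): the tree's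
`Summit.BirchSwinnertonDyer.Rank1Residual.X5.TwoAdicSurjective W := ∀ n > 0, HasSurjectiveModNGaloisRep (2^n)`
versus `SurjModEight W := HasSurjectiveModNGaloisRep 8` (`X5/TwoAdicTargets.lean`); the typer's item
`TwoAdicSurjective_of_mod8` is this file plus the elliptic-curve glue (`E[2ⁿ] ≅ (ℤ/2ⁿ)²` compatibly
in `n`, and `E[2^{n+1}] ↠ E[2ⁿ]`, `P ↦ 2P`), which is NOT here.  No `Summits` import; no named fact
(D-0026); nothing about elliptic curves is asserted.
-/

namespace Literature.NumberTheory.GaloisRepresentations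

open Matrix

section TwoPowers

/-- Private helper: in `ℤ/2^aℤ` every power `2^e` with `a ≤ e` vanishes. [folklore] -/
private theorem two_pow_eq_zero_zmod_two_pow (a e : ℕ) (h : a ≤ e) : (2 : ZMod (2 ^ a)) ^ e = 0 := by
  have h0 : ((2 ^ e : ℕ) : ZMod (2 ^ a)) = 0 := (ZMod.natCast_eq_zero_iff _ _).2 (pow_dvd_pow 2 h)
  simpa using h0

/-- Private helper: kernel of the reduction `ℤ/2^aℤ → ℤ/2^bℤ` (`b ≤ a`) — an element killed by
reduction is a multiple of `2^b`. [folklore] -/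
private theorem exists_eq_two_pow_mul_of_castHom_eq_zero {a b : ℕ} (h : b ≤ a) (x : ZMod (2 ^ a))
    (hx : ZMod.castHom (pow_dvd_pow 2 h) (ZMod (2 ^ b)) x = 0) :
    ∃ y : ZMod (2 ^ a), x = 2 ^ b * y := by
  rw [← ZMod.natCast_zmod_val x, map_natCast, ZMod.natCast_eq_zero_iff] at hx
  obtain ⟨c, hc⟩ := hx
  refine ⟨c, ?_⟩
  rw [← ZMod.natCast_zmod_val x, hc]
  push_cast
  ring

variable {ι : Type*}

/-- Private helper: matrix form of the kernel of reduction — a matrix over `ℤ/2^aℤ` all of whose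
entries die in `ℤ/2^bℤ` is `2^b • A`. [folklore] -/
private theorem exists_eq_two_pow_smul_of_castHom_apply_eq_zero {a b : ℕ} (h : b ≤ a)
    (M : Matrix ι ι (ZMod (2 ^ a)))
    (hM : ∀ i j, ZMod.castHom (pow_dvd_pow 2 h) (ZMod (2 ^ b)) (M i j) = 0) :
    ∃ A : Matrix ι ι (ZMod (2 ^ a)), M = (2 : ZMod (2 ^ a)) ^ b • A := by
  have hex : ∀ i j, ∃ y : ZMod (2 ^ a), M i j = 2 ^ b * y :=
    fun i j => exists_eq_two_pow_mul_of_castHom_eq_zero h (M i j) (hM i j)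
  choose A hA using hex
  refine ⟨Matrix.of A, ?_⟩
  ext i j
  rw [hA i j, Matrix.smul_apply, Matrix.of_apply, smul_eq_mul]

end TwoPowers

section Squaring

/-- Private helper, the algebra of the squaring trick: in any ring, if `a² = ab = ba = b² = 0`, `a + a = t` and
`b + b = 0`, then `(1 + a + b)² = 1 + t`. [folklore] -/
private theorem one_add_add_mul_self_eq {M : Type*} [Ring M] (a b t : M) (haa : a * a = 0)
    (hab : a * b = 0) (hba : b * a = 0) (hbb : b * b = 0) (h2a : a + a = t) (h2b : b + b = 0) :
    (1 + a + b) * (1 + a + b) = 1 + t := by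
  have e : (1 + a + b) * (1 + a + b) = 1 + (a + a) + (b + b) + a * a + a * b + b * a + b * b := by
    noncomm_ring
  rw [e, haa, hab, hba, hbb, h2a, h2b]
  simp only [add_zero]

/-- Private helper: `(1 + X)(1 - X + X²) = 1 + X³` in any ring. [folklore] -/
private theorem one_add_mul_one_sub_add_sq {M : Type*} [Ring M] (X : M) :
    (1 + X) * (1 - X + X * X) = 1 + X * X * X := by
  noncomm_ring

/-- Private helper: `(1 - X + X²)(1 + X) = 1 + X³` in any ring. [folklore] -/
private theorem one_sub_add_sq_mul_one_add {M : Type*} [Ring M] (X : M) :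
    (1 - X + X * X) * (1 + X) = 1 + X * X * X := by
  noncomm_ring

end Squaring

section Lifting

variable {ι : Type*} [Fintype ι] [DecidableEq ι]

/-- **The lifting step (Vasiu 2003, Lemma 4.1.2 at `p = 2`, one finite level; Serre, *Abelian
l-adic representations*, IV-27 Exc. 1).**  Let `3 ≤ k`.  A subgroup `H` of `GL_ι(ℤ/2^{k+1}ℤ)` whose
image under reduction modulo `2^k` is all of `GL_ι(ℤ/2^kℤ)` is all of `GL_ι(ℤ/2^{k+1}ℤ)`.  (False at
`k = 2`: "4 not 8".) [cite: Vasiu2003, Lemma 4.1.2 (p. 11 of arXiv:math/0209237; Manuscripta Math. 112 (2003) 325–355)] -/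
theorem generalLinearGroup_eq_top_of_map_castHom_eq_top {k : ℕ} (hk : 3 ≤ k)
    (H : Subgroup (GL ι (ZMod (2 ^ (k + 1)))))
    (hH : H.map (Matrix.GeneralLinearGroup.map
      (ZMod.castHom (pow_dvd_pow 2 (Nat.le_add_right k 1)) (ZMod (2 ^ k)))) = ⊤) :
    H = ⊤ := by
  obtain ⟨m, rfl⟩ : ∃ m, k = m + 3 := ⟨k - 3, by omega⟩
  -- notation
  set π : GL ι (ZMod (2 ^ (m + 3 + 1))) →* GL ι (ZMod (2 ^ (m + 3))) :=
    Matrix.GeneralLinearGroup.map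
      (ZMod.castHom (pow_dvd_pow 2 (Nat.le_add_right (m + 3) 1)) (ZMod (2 ^ (m + 3)))) with hπ
  have hπ_apply : ∀ (g : GL ι (ZMod (2 ^ (m + 3 + 1)))) (i j : ι),
      (π g : Matrix ι ι (ZMod (2 ^ (m + 3)))) i j =
        ZMod.castHom (pow_dvd_pow 2 (Nat.le_add_right (m + 3) 1)) (ZMod (2 ^ (m + 3)))
          ((g : Matrix ι ι (ZMod (2 ^ (m + 3 + 1)))) i j) :=
    fun g i j => rfl
  -- powers of two in `R = ℤ/2^(m+4)ℤ`
  have hz : ∀ e : ℕ, m + 3 + 1 ≤ e → (2 : ZMod (2 ^ (m + 3 + 1))) ^ e = 0 :=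
    fun e he => two_pow_eq_zero_zmod_two_pow _ _ he
  have hcc : (2 : ZMod (2 ^ (m + 3 + 1))) ^ (m + 2) * 2 ^ (m + 2) = 0 := by
    rw [← pow_add]; exact hz _ (by omega)
  have hcd : (2 : ZMod (2 ^ (m + 3 + 1))) ^ (m + 2) * 2 ^ (m + 3) = 0 := by
    rw [← pow_add]; exact hz _ (by omega)
  have hdc : (2 : ZMod (2 ^ (m + 3 + 1))) ^ (m + 3) * 2 ^ (m + 2) = 0 := by
    rw [← pow_add]; exact hz _ (by omega)
  have hdd : (2 : ZMod (2 ^ (m + 3 + 1))) ^ (m + 3) * 2 ^ (m + 3) = 0 := by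
    rw [← pow_add]; exact hz _ (by omega)
  have hc2 : (2 : ZMod (2 ^ (m + 3 + 1))) ^ (m + 2) + 2 ^ (m + 2) = 2 ^ (m + 3) := by
    rw [← two_mul, ← pow_succ']
  have hd2 : (2 : ZMod (2 ^ (m + 3 + 1))) ^ (m + 3) + 2 ^ (m + 3) = 0 := by
    rw [← two_mul, ← pow_succ']; exact hz _ (by omega)
  -- Step 1: it suffices that the kernel of `π` lies in `H`
  suffices hker : ∀ κ : GL ι (ZMod (2 ^ (m + 3 + 1))), π κ = 1 → κ ∈ H by
    rw [eq_top_iff]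
    intro g _
    have hg : π g ∈ H.map π := by rw [hH]; exact Subgroup.mem_top _
    obtain ⟨h, hh, hhg⟩ := Subgroup.mem_map.1 hg
    have hk : π (h⁻¹ * g) = 1 := by rw [map_mul, map_inv, hhg, inv_mul_cancel]
    have := H.mul_mem hh (hker _ hk)
    simpa using this
  intro κ hκ
  -- Step 2: `κ = 1 + d • A`
  have hκ_entries : ∀ i j,
      ZMod.castHom (pow_dvd_pow 2 (Nat.le_add_right (m + 3) 1)) (ZMod (2 ^ (m + 3)))
        (((κ : Matrix ι ι (ZMod (2 ^ (m + 3 + 1)))) - 1) i j) = 0 := by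
    intro i j
    have h1 := hπ_apply κ i j
    rw [hκ] at h1
    rw [Matrix.sub_apply, map_sub, ← h1, Units.val_one, Matrix.one_apply, Matrix.one_apply]
    split_ifs <;> simp only [map_one, map_zero, sub_self]
  obtain ⟨A, hA⟩ := exists_eq_two_pow_smul_of_castHom_apply_eq_zero (Nat.le_add_right (m + 3) 1) _ hκ_entries
  have hκA : (κ : Matrix ι ι (ZMod (2 ^ (m + 3 + 1)))) =
      1 + (2 : ZMod (2 ^ (m + 3 + 1))) ^ (m + 3) • A :=
    sub_eq_iff_eq_add'.1 hA
  -- Step 3: the unit `u₀ = 1 + c • A`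
  set X : Matrix ι ι (ZMod (2 ^ (m + 3 + 1))) := (2 : ZMod (2 ^ (m + 3 + 1))) ^ (m + 2) • A
    with hX
  have hX3 : X * X * X = 0 := by
    simp only [hX, Matrix.smul_mul, Matrix.mul_smul, smul_smul, hcc, zero_mul, zero_smul]
  let u₀ : GL ι (ZMod (2 ^ (m + 3 + 1))) :=
    ⟨1 + X, 1 - X + X * X,
      by rw [one_add_mul_one_sub_add_sq, hX3, add_zero],
      by rw [one_sub_add_sq_mul_one_add, hX3, add_zero]⟩
  have hu₀ : (u₀ : Matrix ι ι (ZMod (2 ^ (m + 3 + 1)))) = 1 + X := rfl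
  -- Step 4: some `h ∈ H` reduces like `u₀`
  have hu : π u₀ ∈ H.map π := by rw [hH]; exact Subgroup.mem_top _
  obtain ⟨h, hhH, hπh⟩ := Subgroup.mem_map.1 hu
  -- Step 5: `h = 1 + X + d • B`
  have hh_entries : ∀ i j,
      ZMod.castHom (pow_dvd_pow 2 (Nat.le_add_right (m + 3) 1)) (ZMod (2 ^ (m + 3)))
        (((h : Matrix ι ι (ZMod (2 ^ (m + 3 + 1)))) - (1 + X)) i j) = 0 := by
    intro i j
    have h1 := hπ_apply h i j
    have h2 := hπ_apply u₀ i j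
    rw [hπh] at h1
    rw [Matrix.sub_apply, map_sub, ← hu₀, ← h2, ← h1, sub_self]
  obtain ⟨B, hB⟩ := exists_eq_two_pow_smul_of_castHom_apply_eq_zero (Nat.le_add_right (m + 3) 1) _ hh_entries
  have hhB : (h : Matrix ι ι (ZMod (2 ^ (m + 3 + 1)))) =
      1 + X + (2 : ZMod (2 ^ (m + 3 + 1))) ^ (m + 3) • B :=
    sub_eq_iff_eq_add'.1 hB
  -- Step 6: `h * h = κ`
  have hsq : (h : Matrix ι ι (ZMod (2 ^ (m + 3 + 1)))) * h = κ := by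
    rw [hhB, hκA]
    apply one_add_add_mul_self_eq
    · rw [hX, Matrix.smul_mul, Matrix.mul_smul, smul_smul, hcc, zero_smul]
    · rw [hX, Matrix.smul_mul, Matrix.mul_smul, smul_smul, hcd, zero_smul]
    · rw [hX, Matrix.smul_mul, Matrix.mul_smul, smul_smul, hdc, zero_smul]
    · rw [Matrix.smul_mul, Matrix.mul_smul, smul_smul, hdd, zero_smul]
    · rw [hX, ← add_smul, hc2]
    · rw [← add_smul, hd2, zero_smul]
  have hhκ : h * h = κ := Units.ext (by rw [Units.val_mul]; exact hsq)
  rw [← hhκ]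
  exact H.mul_mem hhH hhH

/-- **Image form of the lifting step.**  Let `3 ≤ k` and `ρ : G →* GL_ι(ℤ/2^{k+1}ℤ)` be a
homomorphism whose reduction modulo `2^k` is surjective; then `ρ` is surjective.
[cite: Vasiu2003, Lemma 4.1.2] -/
theorem surjective_of_surjective_castHom_comp {G : Type*} [Group G] {k : ℕ} (hk : 3 ≤ k)
    (ρ : G →* GL ι (ZMod (2 ^ (k + 1))))
    (hρ : Function.Surjective ((Matrix.GeneralLinearGroup.map
      (ZMod.castHom (pow_dvd_pow 2 (Nat.le_add_right k 1)) (ZMod (2 ^ k)))).comp ρ)) :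
    Function.Surjective ρ := by
  rw [← MonoidHom.range_eq_top]
  refine generalLinearGroup_eq_top_of_map_castHom_eq_top hk ρ.range (eq_top_iff.2 fun x _ => ?_)
  obtain ⟨g, hg⟩ := hρ x
  exact Subgroup.mem_map.2 ⟨ρ g, ⟨g, rfl⟩, hg⟩

/-- **Surjectivity is decided modulo `8` (iterated lifting).**  Let `3 ≤ k`.  A subgroup of
`GL_ι(ℤ/2^kℤ)` whose image under reduction modulo `2^3 = 8` is all of `GL_ι(ℤ/8ℤ)` is all of
`GL_ι(ℤ/2^kℤ)`. [cite: Vasiu2003, Lemma 4.1.2 (p = 2, m = 3)] -/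
theorem generalLinearGroup_eq_top_of_map_castHom_eight_eq_top {k : ℕ} (hk : 3 ≤ k)
    (H : Subgroup (GL ι (ZMod (2 ^ k))))
    (hH : H.map (Matrix.GeneralLinearGroup.map
      (ZMod.castHom (pow_dvd_pow 2 hk) (ZMod (2 ^ 3)))) = ⊤) :
    H = ⊤ := by
  induction k, hk using Nat.le_induction with
  | base =>
    have hid : ZMod.castHom (pow_dvd_pow 2 (le_refl 3)) (ZMod (2 ^ 3)) = RingHom.id _ :=
      Subsingleton.elim _ _
    rw [hid, Matrix.GeneralLinearGroup.map_id, Subgroup.map_id] at hH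
    exact hH
  | succ k hk ih =>
    have hcomp : ZMod.castHom (pow_dvd_pow 2 (hk.trans (Nat.le_add_right k 1))) (ZMod (2 ^ 3)) =
        (ZMod.castHom (pow_dvd_pow 2 hk) (ZMod (2 ^ 3))).comp
          (ZMod.castHom (pow_dvd_pow 2 (Nat.le_add_right k 1)) (ZMod (2 ^ k))) :=
      Subsingleton.elim _ _
    rw [hcomp, Matrix.GeneralLinearGroup.map_comp, ← Subgroup.map_map] at hH
    exact generalLinearGroup_eq_top_of_map_castHom_eq_top hk H (ih _ hH)

/-- **Image form: a homomorphism to `GL_ι(ℤ/2^kℤ)`, `3 ≤ k`, is surjective as soon as its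
reduction modulo `8` is.**  (For the `2`-adic representation of an elliptic curve: `ρ̄_{E,2^k}` is
surjective for every `k ≥ 3` iff `ρ̄_{E,8}` is — the group-theoretic half of "`SurjModEight` decides
`TwoAdicSurjective`"; the levels `k = 1, 2` follow downward from `k = 3`.)
[cite: Vasiu2003, Lemma 4.1.2 (p = 2, m = 3)] -/
theorem surjective_of_surjective_castHom_eight_comp {G : Type*} [Group G] {k : ℕ} (hk : 3 ≤ k)
    (ρ : G →* GL ι (ZMod (2 ^ k)))
    (hρ : Function.Surjective ((Matrix.GeneralLinearGroup.map
      (ZMod.castHom (pow_dvd_pow 2 hk) (ZMod (2 ^ 3)))).comp ρ)) :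
    Function.Surjective ρ := by
  rw [← MonoidHom.range_eq_top]
  refine generalLinearGroup_eq_top_of_map_castHom_eight_eq_top hk ρ.range
    (eq_top_iff.2 fun x _ => ?_)
  obtain ⟨g, hg⟩ := hρ x
  exact Subgroup.mem_map.2 ⟨ρ g, ⟨g, rfl⟩, hg⟩

end Lifting

end Literature.NumberTheory.GaloisRepresentations
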